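/- Copyright: the b2b-balaban cell (near-miss cell 7), T⁴-continuum fan-out, lineage t4-ne7b-formalise-leaf-06 (NE7b CRUX
TEAM (2) leaf prover 06), gen 32: «THE ROUNDING WINDOW», file 3∕3 (supplier-facing forms).  Released under the licence of the surrounding project. -/
import Summits.QuantumFields.BalabanUV.T4Continuum.Support.HistoryBankingRoundingWindow
import Summits.QuantumFields.BalabanUV.T4Continuum.Support.HistoryBankingFibreRoom

/-!
# History banking, M5-3 (γ′) file 3∕3, the supplier-facing forms: THE WINDOW FROM ONE THRESHOLD `ℓ_j ≥ ℓ⋆` AND FROM THE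
COUPLINGS `0 < g_j ≤ γ ≤ e^{−ℓ⋆∕2}`; THE OWNER's FIBRE JUNCTION `RoundingRoomF` (M5-4a) AT PRINT'S SHARP LETTERS FOR FIBRE
SHARES WITHIN THE RESERVED ROOM (route R-P1 of row NE7b; re-open object (α), `WALL-NE7b-P1.md` v1.19 §5 (o), residue (γ′);
R-OWNER-46-1 (c))

Summits-side support leaf of the T⁴-continuum cell (rung (B)+1 on a FINITE torus only; NOT infinite volume, NOT the
mass gap, NOT the Clay statement; NOT a proof of the spine estimate NE7b — the cell's OWN estimate, NOT PRINTED, NOT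
PROVED).  [folklore] real arithmetic (real roots `Real.rpow`, logarithms) over the siblings `HistoryBankingSharpShares`
(`ell`, `S0`, `sBsharp`, `sRsharp`) and `HistoryBankingRoundingWindow` (`structure SharpWindow`, `birth_clause`, `renew_clause`),
and the OWNER t4-ne7b-p1 g46's row-S22 (a) `HistoryBankingFibreRoom` (`structure RoundingRoomF`, R-OWNER-46-1 (c)); no
`[cite:]` tag, nothing printed asserted, no `def … : Prop`, zero `sorry`.

WHY.  The window `SharpWindow` of the sibling has four clauses «constant ≤ constant·ℓ_j^{exponent}» per performed step;
the END's quantifier prefix is `ForSmallCouplings` («every coupling of the run in `]0, γ]`»).  This file closes the gap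
between the two shapes: ONE closed-form threshold `ℓ⋆` (a `max` of real roots of the four constants) such that
`ℓ⋆ ≤ ℓ_j` (`j ≤ K`) gives the window, and the coupling form `0 < g_j ≤ γ ≤ e^{−ℓ⋆∕2}` gives `ℓ⋆ ≤ ℓ_j`.  And the
sibling's clauses were proved with room `(1+Φ)·(shares)`: §2 spends it on the OWNER's fibre junction `RoundingRoomF …
φB φR` (the `resumM` spec R-OWNER-46-1 (c): a displayed per-event FIBRE SHARE of volume type booked next to the discount
shares) — for every fibre share within the budget `φB j d′ ≤ Φ·dshare(birth j d′)`, `φR h ≤ Φ·dshare(renewal at h+1)`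
(displays), `RoundingRoomF` HOLDS at print's sharp letters on the same window.

WHAT.  `le_pow_of_rpow_inv_le` (`0 ≤ c`, `1 ≤ n`, `c^{1∕n} ≤ x` ⇒ `c ≤ x^n`); **`ellStar C O L t η η′ κ Ap₁ Φ`** `= max{1,
(2A₀L^{t}∕Ap₁²)^{1∕η}, (48(1+Φ)L^{3(q′+1)}L^{t}∕Ap₁²)^{1∕η′}, (8∕(γ₀A₁²A₀))^{1∕p₀}, (4(1+Φ)S₀L^{3(q′+1)}∕(γ₀A₁²A₀²))^{1∕κ}}`;
**`sharpWindow_of_threshold`** (exponent bookkeeping, gaps `η, η′, κ ≥ 1`, `p₀ ≥ 1`, `Ap₁ ≠ 0`, `γ₀ > 0`, `A₁ ≠ 0`,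
`A₀ > 0`, `Φ ≥ 0`, `E₂ > 0`, `E₃ ≥ 0`, and `ℓ⋆ ≤ ℓ_j` for `j ≤ K` ⇒ `SharpWindow`); `le_ell_of_coupling` (`0 < g_j ≤ γ ≤
e^{−x∕2}` ⇒ `x ≤ ℓ_j`); **`sharpWindow_of_couplings`**.  §2 `dshare_mk0_eq`, `dshare_mk1_eq` (a share reads only (step, kind,
class)); **`roundingRoomF_sharp`**: `RoundingRoomF C O L K R g (sBsharp O m C g) (sRsharp t Ap₁ p₁ R g) φB φR` under the
sibling's hypotheses and the two budget displays; **`roundingRoomF_sharp_of_couplings`** (the END-facing one-call form: from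
the couplings `0 < g_j ≤ γ ≤ e^{−ℓ⋆∕2}`, (2.9), (2.5) `B14.IsRj`, constants, budgets); `roundingRoom_mono` ∕ `roundingRoomF_mono` ∕
**`roundingRoomF_of_dominating`** (any sharp letters DOMINATING the letters of record — e.g. the refuter's unrounded `S_h`, print's full
p. 381 exponent — inherit the discharge on the nose).

HONEST SCOPE.  Real arithmetic over OUR carriers; `SharpWindow` is a HYPOTHESIS shape (a smallness of OUR letters,
reducible to `g_j ≤ γ ≤ e^{−ℓ⋆∕2}`); nothing of H3 ∕ (B) ∕ BetaPertH is discharged; what stays displayed after this file is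
`FactorRead (fB K) (fR K) (sBsharp …) (sRsharp …)` (the VALUES of M2 brick B's factors below print's sharp exponents — H3's
identification) and the window.  Nothing of Bałaban's is asserted or contested: «g_j sufficiently small» is typed as an
explicit window, nothing more.  NE7b NOT PRINTED ∕ NOT PROVED; spine 0∕9; rung (B)+1 on a FINITE torus — NOT infinite
volume, NOT the mass gap, NOT Clay.  HONEST DEPENDENCY (cell): continuum YM on T⁴ ⇐ BetaPertH ∧ nine spine estimates (0/9
proved); BetaPertH ⇐ (D1) ∧ (D4) ∧ CAP+tail; G-an2-4 gates asym, D1 and NE2/3/4.  This file changes none of it.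
-/

open Finset
open Literature.MathematicalPhysics.QuantumFieldTheory.Balaban1983to89
open T4PersistenceDictionary T4PrintedShapeBanking
open Summit.QuantumFields.BalabanUV.T4Continuum.HistoryConstants
open Summit.QuantumFields.BalabanUV.T4Continuum.HistoryBankingSharpShares
open Summit.QuantumFields.BalabanUV.T4Continuum.HistoryBankingDiscountCharge
open Summit.QuantumFields.BalabanUV.T4Continuum.HistoryBankingRoundingWindow
open Summit.QuantumFields.BalabanUV.T4Continuum.HistoryBankingFibreRoom

namespace Summit.QuantumFields.BalabanUV.T4Continuum.HistoryBankingRoundingSupply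

noncomputable section

/-! ## §1 ONE threshold `ℓ⋆` and the coupling form `g_j ≤ γ ≤ e^{−ℓ⋆∕2}` -/

section Threshold

/-- from a real root to a power: `0 ≤ c`, `1 ≤ n`, `c^{1∕n} ≤ x` ⇒ `c ≤ x^n`. [folklore] -/
theorem le_pow_of_rpow_inv_le {c x : ℝ} {n : ℕ} (hc : 0 ≤ c) (hn : 1 ≤ n) (hx : c ^ ((1 : ℝ) / n) ≤ x) :
    c ≤ x ^ n := by
  have h0 : 0 ≤ c ^ ((1 : ℝ) / n) := Real.rpow_nonneg hc _
  have hn0 : (n : ℝ) ≠ 0 := Nat.cast_ne_zero.2 (by omega)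
  have h1 : (c ^ ((1 : ℝ) / n)) ^ n = c := by
    rw [← Real.rpow_natCast, ← Real.rpow_mul hc, one_div_mul_cancel hn0, Real.rpow_one]
  calc c = (c ^ ((1 : ℝ) / n)) ^ n := h1.symm
    _ ≤ x ^ n := pow_le_pow_left₀ h0 hx n

/-- **THE THRESHOLD** `ℓ⋆ = max{1, (2A₀L^{t}∕Ap₁²)^{1∕η}, (48(1+Φ)L^{3(q′+1)}L^{t}∕Ap₁²)^{1∕η′}, (8∕(γ₀A₁²A₀))^{1∕p₀},
(4(1+Φ)S₀L^{3(q′+1)}∕(γ₀A₁²A₀²))^{1∕κ}}` (real roots; a closed-form function of the constants). [folklore] -/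
def ellStar (C : T4PrintedShapeBanking.Consts) (O : PrintedO1s) (L t η η' κ : ℕ) (Ap₁ Φ : ℝ) : ℝ :=
  max 1 (max
    (max ((2 * C.A₀ * (L : ℝ) ^ t / Ap₁ ^ 2) ^ ((1 : ℝ) / η))
      ((48 * (1 + Φ) * (L : ℝ) ^ (3 * (C.q' + 1)) * (L : ℝ) ^ t / Ap₁ ^ 2) ^ ((1 : ℝ) / η')))
    (max ((8 / (O.γ₀ * O.A₁ ^ 2 * C.A₀)) ^ ((1 : ℝ) / C.p₀))
      ((4 * (1 + Φ) * S0 C * (L : ℝ) ^ (3 * (C.q' + 1)) / (O.γ₀ * O.A₁ ^ 2 * C.A₀ ^ 2)) ^ ((1 : ℝ) / κ))))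

variable {C : T4PrintedShapeBanking.Consts} {O : PrintedO1s} {L K r p₁ t η η' κ : ℕ} {Ap₁ Φ : ℝ} {g : ℕ → ℝ}

/-- **THE WINDOW FROM ONE THRESHOLD**: with the exponent bookkeeping, gaps `η, η′, κ ≥ 1`, `p₀ ≥ 1`, `Ap₁ ≠ 0`,
`γ₀ > 0`, `A₁ ≠ 0`, `A₀ > 0`, `Φ ≥ 0`, `E₂ > 0`, `E₃ ≥ 0`: if `ℓ⋆ ≤ ℓ_j` for every `j ≤ K` then
`SharpWindow C O L K r p₁ η η′ κ Ap₁ Φ g`. [folklore] -/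
theorem sharpWindow_of_threshold (hexpR : C.p₀ + r * t + η = 2 * p₁)
    (hexpR' : r * (C.q' + 1) + r * t + η' = 2 * p₁) (hexpB : r * (C.q' + 1) + κ = 2 * C.p₀)
    (hη : 1 ≤ η) (hη' : 1 ≤ η') (hκ : 1 ≤ κ) (hp₀ : 1 ≤ C.p₀) (hAp : Ap₁ ≠ 0) (hγ₀ : 0 < O.γ₀) (hA₁ : O.A₁ ≠ 0)
    (hA₀ : 0 < C.A₀) (hΦ : 0 ≤ Φ) (hE₂ : 0 < C.E₂) (hE₃ : 0 ≤ C.E₃)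
    (hwin : ∀ j, j ≤ K → ellStar C O L t η η' κ Ap₁ Φ ≤ ell g j) :
    SharpWindow C O L K r p₁ t η η' κ Ap₁ Φ g := by
  have hAp2 : 0 < Ap₁ ^ 2 := by positivity
  have hA12 : 0 < O.A₁ ^ 2 := by positivity
  have hq1 : 0 < O.γ₀ * O.A₁ ^ 2 * C.A₀ := by positivity
  have hq2 : 0 < O.γ₀ * O.A₁ ^ 2 * C.A₀ ^ 2 := by positivity
  have hS : 0 ≤ S0 C := S0_nonneg hE₂.le hE₃
  have hL0 : (0 : ℝ) ≤ L := Nat.cast_nonneg _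
  -- unpack the five members of the max at a step `j ≤ K`
  have hle : ∀ j, j ≤ K →
      1 ≤ ell g j ∧
      (2 * C.A₀ * (L : ℝ) ^ t / Ap₁ ^ 2) ^ ((1 : ℝ) / η) ≤ ell g j ∧
      (48 * (1 + Φ) * (L : ℝ) ^ (3 * (C.q' + 1)) * (L : ℝ) ^ t / Ap₁ ^ 2) ^ ((1 : ℝ) / η') ≤ ell g j ∧
      (8 / (O.γ₀ * O.A₁ ^ 2 * C.A₀)) ^ ((1 : ℝ) / C.p₀) ≤ ell g j ∧
      (4 * (1 + Φ) * S0 C * (L : ℝ) ^ (3 * (C.q' + 1)) / (O.γ₀ * O.A₁ ^ 2 * C.A₀ ^ 2)) ^ ((1 : ℝ) / κ) ≤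
        ell g j := by
    intro j hj
    have h := hwin j hj
    unfold ellStar at h
    simp only [max_le_iff] at h
    exact ⟨h.1, h.2.1.1, h.2.1.2, h.2.2.1, h.2.2.2⟩
  refine ⟨hexpR, hexpR', hexpB, fun j hj => (hle j hj).1, fun j hj => ?_, fun j hj => ?_, fun j hj => ?_,
    fun j hj => ?_⟩
  · have h := le_pow_of_rpow_inv_le (by positivity) hη (hle j hj).2.1
    rw [div_le_iff₀ hAp2] at h
    linarith
  · have h := le_pow_of_rpow_inv_le (by positivity) hη' (hle j hj).2.2.1
    rw [div_le_iff₀ hAp2] at h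
    linarith
  · have h := le_pow_of_rpow_inv_le (by positivity) hp₀ (hle j hj).2.2.2.1
    rw [div_le_iff₀ hq1] at h
    linarith
  · have h := le_pow_of_rpow_inv_le (by positivity) hκ (hle j hj).2.2.2.2
    rw [div_le_iff₀ hq2] at h
    linarith

/-- a coupling below `γ ≤ e^{−x∕2}` has `ℓ = log g⁻² ≥ x`. [folklore] -/
theorem le_ell_of_coupling {x γ : ℝ} {g : ℕ → ℝ} {j : ℕ} (hg : 0 < g j) (hgγ : g j ≤ γ)
    (hγ : γ ≤ Real.exp (-(x / 2))) : x ≤ ell g j := by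
  unfold ell
  have hγ0 : 0 < γ := lt_of_lt_of_le hg hgγ
  have h1 : Real.log γ ≤ -(x / 2) := by
    have := Real.log_le_log hγ0 hγ
    rwa [Real.log_exp] at this
  have h2 : Real.log (g j) ≤ Real.log γ := Real.log_le_log hg hgγ
  rw [Real.log_inv, Real.log_pow]
  push_cast
  linarith

/-- **THE WINDOW FROM THE COUPLINGS** (the `ForSmallCouplings`-facing form): if every coupling of the performed range is
in `]0, γ]` with `γ ≤ e^{−ℓ⋆∕2}`, the window holds (same side conditions as `sharpWindow_of_threshold`). [folklore] -/
theorem sharpWindow_of_couplings {γ : ℝ} (hexpR : C.p₀ + r * t + η = 2 * p₁)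
    (hexpR' : r * (C.q' + 1) + r * t + η' = 2 * p₁) (hexpB : r * (C.q' + 1) + κ = 2 * C.p₀)
    (hη : 1 ≤ η) (hη' : 1 ≤ η') (hκ : 1 ≤ κ) (hp₀ : 1 ≤ C.p₀) (hAp : Ap₁ ≠ 0) (hγ₀ : 0 < O.γ₀) (hA₁ : O.A₁ ≠ 0)
    (hA₀ : 0 < C.A₀) (hΦ : 0 ≤ Φ) (hE₂ : 0 < C.E₂) (hE₃ : 0 ≤ C.E₃)
    (hγ : γ ≤ Real.exp (-(ellStar C O L t η η' κ Ap₁ Φ / 2))) (hg : ∀ j, j ≤ K → 0 < g j ∧ g j ≤ γ) :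
    SharpWindow C O L K r p₁ t η η' κ Ap₁ Φ g :=
  sharpWindow_of_threshold hexpR hexpR' hexpB hη hη' hκ hp₀ hAp hγ₀ hA₁ hA₀ hΦ hE₂ hE₃
    fun j hj => le_ell_of_coupling (hg j hj).1 (hg j hj).2 hγ

end Threshold

/-! ## §2 The OWNER's fibre junction `RoundingRoomF` at print's sharp letters, for fibre shares within the reserved room -/

section Fibre

variable {C : T4PrintedShapeBanking.Consts} {O : PrintedO1s} {L K r p₁ t η η' κ : ℕ} {Ap₁ Φ m : ℝ} {R : ℕ → ℕ}
  {g : ℕ → ℝ} {β' β₀ : ℝ} {φB : ℕ → ℕ → ℝ} {φR : ℕ → ℝ}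

/-- a kind-`0` event's discount share is the share of the triple (step, `0`, class). [folklore] -/
theorem dshare_mk0_eq {e : PEv} (h : e.kind = 0) : dshare C L R ((e.step, 0, e.fat) : PEv) = dshare C L R e := by
  rw [dshare_kind0_eq h, dshare_kind0_eq (show PEv.kind ((e.step, 0, e.fat) : PEv) = 0 from rfl)]
  simp only [PEv.step_mk, PEv.fat_mk]

/-- a kind-`1` event's discount share is the share of the triple (step, `1`, `0`). [folklore] -/
theorem dshare_mk1_eq {e : PEv} (h : e.kind = 1) (h1 : 1 ≤ e.step) :
    dshare C L R ((e.step - 1 + 1, 1, 0) : PEv) = dshare C L R e := by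
  rw [Nat.sub_add_cancel h1, dshare_kind1_eq h, dshare_kind1_eq (show PEv.kind ((e.step, 1, 0) : PEv) = 1 from rfl)]
  simp only [PEv.step_mk]

/-- **`RoundingRoomF` AT PRINT'S SHARP LETTERS FOR FIBRE SHARES WITHIN THE ROOM** (R-OWNER-46-1 (c), the OWNER's M5-4a
`HistoryBankingFibreRoom.RoundingRoomF`): under the hypotheses of `roundingRoom_sharp` with multiplier `Φ ≥ 0` and the two
budget DISPLAYS `φB j d′ ≤ Φ·dshare C L R (j, 0, d′)`, `φR h ≤ Φ·dshare C L R (h+1, 1, 0)` (fibre shares of volume type,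
booked within the reserved room), `RoundingRoomF C O L K R g (sBsharp O m C g) (sRsharp t Ap₁ p₁ R g) φB φR`. [folklore] -/
theorem roundingRoomF_sharp (hE₂ : 0 < C.E₂) (hE₃ : 0 ≤ C.E₃) (hL : 1 ≤ L) (hγ₀ : 0 ≤ O.γ₀) (hA₀ : 0 ≤ C.A₀)
    (hΦ : 0 ≤ Φ) (hm : O.A₁ ^ 2 ≤ m)
    (h29 : B14FlowStep.FlowIneq29 R g L β' β₀ K) (hRup : ∀ j, j ≤ K → (R j : ℝ) ≤ L * ell g j ^ r)
    (hR1 : ∀ j, j ≤ K → 1 ≤ R j) (hW : SharpWindow C O L K r p₁ t η η' κ Ap₁ Φ g)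
    (hφB : ∀ j d', φB j d' ≤ Φ * dshare C L R ((j, 0, d') : PEv))
    (hφR : ∀ h, φR h ≤ Φ * dshare C L R ((h + 1, 1, 0) : PEv)) :
    RoundingRoomF C O L K R g (sBsharp O m C g) (sRsharp t Ap₁ p₁ R g) φB φR where
  birth e he s hjs hsK := by
    have h := birth_clause hE₂ hE₃ hL hγ₀ hA₀ hΦ hm h29 hRup hW he hjs hsK
    have hb := hφB e.step e.fat
    rw [dshare_mk0_eq he] at hb
    have h0 : 0 ≤ Φ * mshare C L R s := mul_nonneg hΦ (mshare_nonneg hE₂.le hE₃ s)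
    linarith
  renew e he h1 hK := by
    have h := renew_clause hL hA₀ hΦ h29 hRup hR1 hW he hK
    have hr := hφR (e.step - 1)
    rw [dshare_mk1_eq he h1] at hr
    linarith

/-- **`RoundingRoomF` AT PRINT'S SHARP LETTERS FROM THE COUPLINGS AND (2.5)** (the END-facing one-call form): exponent
bookkeeping, gaps `≥ 1`, `p₀ ≥ 1`, `Ap₁ ≠ 0`, `γ₀ > 0`, `A₁ ≠ 0`, `A₀ > 0`, `Φ ≥ 0`, `E₂ > 0`, `E₃ ≥ 0`, `L ≥ 1`, `A₁² ≤ m`,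
(2.9), (2.5) `B14.IsRj L r (g_j) (R_j)` (`j ≤ K`), every coupling `0 < g_j ≤ γ ≤ e^{−ℓ⋆∕2}` (`j ≤ K`), and the φ-budgets
⇒ `RoundingRoomF C O L K R g (sBsharp O m C g) (sRsharp t Ap₁ p₁ R g) φB φR`. [folklore] -/
theorem roundingRoomF_sharp_of_couplings {γ : ℝ} (hexpR : C.p₀ + r * t + η = 2 * p₁)
    (hexpR' : r * (C.q' + 1) + r * t + η' = 2 * p₁) (hexpB : r * (C.q' + 1) + κ = 2 * C.p₀)
    (hη : 1 ≤ η) (hη' : 1 ≤ η') (hκ : 1 ≤ κ) (hp₀ : 1 ≤ C.p₀) (hAp : Ap₁ ≠ 0) (hγ₀ : 0 < O.γ₀) (hA₁ : O.A₁ ≠ 0)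
    (hA₀ : 0 < C.A₀) (hΦ : 0 ≤ Φ) (hE₂ : 0 < C.E₂) (hE₃ : 0 ≤ C.E₃) (hL : 1 ≤ L) (hm : O.A₁ ^ 2 ≤ m)
    (h29 : B14FlowStep.FlowIneq29 R g L β' β₀ K) (hRj : ∀ j, j ≤ K → B14.IsRj L r (g j) (R j))
    (hγ : γ ≤ Real.exp (-(ellStar C O L t η η' κ Ap₁ Φ / 2))) (hg : ∀ j, j ≤ K → 0 < g j ∧ g j ≤ γ)
    (hφB : ∀ j d', φB j d' ≤ Φ * dshare C L R ((j, 0, d') : PEv))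
    (hφR : ∀ h, φR h ≤ Φ * dshare C L R ((h + 1, 1, 0) : PEv)) :
    RoundingRoomF C O L K R g (sBsharp O m C g) (sRsharp t Ap₁ p₁ R g) φB φR :=
  have hW := sharpWindow_of_couplings hexpR hexpR' hexpB hη hη' hκ hp₀ hAp hγ₀ hA₁ hA₀ hΦ hE₂ hE₃ hγ hg
  roundingRoomF_sharp hE₂ hE₃ hL hγ₀.le hA₀.le hΦ hm h29
    (fun j hj => (envelope_of_isRj hL (hRj j hj) (hW.one_le_ell j hj)).1)
    (fun j hj => (envelope_of_isRj hL (hRj j hj) (hW.one_le_ell j hj)).2) hW hφB hφR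

/-- **MONOTONICITY IN THE SHARP LETTERS** (gen 45's junction): sharp letters dominating a discharged pair on the nose
inherit the discharge — e.g. the UNROUNDED renewal exponent `S_h` of [B16] p. 383 (refuter PRICING-NE7b v13 L-v13-1 ∕
F73 (v)), which dominates `sRsharp (d+3) Ap₁′ p₁ R g` when `β₀(d+2) ≤ 1` and `R ≥ 1`, or any birth letter `≥ sBsharp`.
[folklore] -/
theorem roundingRoom_mono {sB sB' : ℕ → ℕ → ℝ} {sR sR' : ℕ → ℝ} (hB : ∀ j d, sB j d ≤ sB' j d)
    (hR : ∀ h, sR h ≤ sR' h) (h : RoundingRoom C O L K R g sB sR) : RoundingRoom C O L K R g sB' sR' where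
  birth e he s hs hsK := (h.birth e he s hs hsK).trans (hB _ _)
  renew e he h1 hK := (h.renew e he h1 hK).trans (hR _)

/-- **MONOTONICITY IN THE SHARP LETTERS** (the OWNER's booked junction `RoundingRoomF`, fibre shares fixed). [folklore] -/
theorem roundingRoomF_mono {sB sB' : ℕ → ℕ → ℝ} {sR sR' : ℕ → ℝ} (hB : ∀ j d, sB j d ≤ sB' j d)
    (hR : ∀ h, sR h ≤ sR' h) (h : RoundingRoomF C O L K R g sB sR φB φR) :
    RoundingRoomF C O L K R g sB' sR' φB φR where
  birth e he s hs hsK := (h.birth e he s hs hsK).trans (hB _ _)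
  renew e he h1 hK := (h.renew e he h1 hK).trans (hR _)

/-- **`RoundingRoomF` AT ANY SHARP LETTERS DOMINATING THE LETTERS OF RECORD** (e.g. `sR := S_h` unrounded, `sB :=` print's
full p. 381 exponent): the window discharge transfers on the nose. [folklore] -/
theorem roundingRoomF_of_dominating {sB' : ℕ → ℕ → ℝ} {sR' : ℕ → ℝ} (hE₂ : 0 < C.E₂) (hE₃ : 0 ≤ C.E₃) (hL : 1 ≤ L)
    (hγ₀ : 0 ≤ O.γ₀) (hA₀ : 0 ≤ C.A₀) (hΦ : 0 ≤ Φ) (hm : O.A₁ ^ 2 ≤ m)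
    (h29 : B14FlowStep.FlowIneq29 R g L β' β₀ K) (hRup : ∀ j, j ≤ K → (R j : ℝ) ≤ L * ell g j ^ r)
    (hR1 : ∀ j, j ≤ K → 1 ≤ R j) (hW : SharpWindow C O L K r p₁ t η η' κ Ap₁ Φ g)
    (hφB : ∀ j d', φB j d' ≤ Φ * dshare C L R ((j, 0, d') : PEv))
    (hφR : ∀ h, φR h ≤ Φ * dshare C L R ((h + 1, 1, 0) : PEv))
    (hB : ∀ j d, sBsharp O m C g j d ≤ sB' j d) (hRR : ∀ h, sRsharp t Ap₁ p₁ R g h ≤ sR' h) :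
    RoundingRoomF C O L K R g sB' sR' φB φR :=
  roundingRoomF_mono hB hRR (roundingRoomF_sharp hE₂ hE₃ hL hγ₀ hA₀ hΦ hm h29 hRup hR1 hW hφB hφR)

end Fibre

end

end Summit.QuantumFields.BalabanUV.T4Continuum.HistoryBankingRoundingSupply
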